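import Mathlib
import Literature.Topology.FourManifolds.MMSWRasmussen
import Literature.Topology.FourManifolds.MMSWRasmussenFacts
import Literature.Topology.FourManifolds.DehnSurgery
import Literature.Topology.FourManifolds.KirbyMoves
import Literature.Topology.FourManifolds.Cobordism
import Summits.SmoothPoincare4.SmoothPoincare4.Theses.DottedCircleRasmussen

/-!
# Sketch — crux `DcrGap` (stmt-SmoothPoincare4-16128), crux-ideate round 1, ideator 1

First lemmas of two crux ideas, typed over existing declarations (no `sorry`; nothing is proved):

* `MkFriendsLemma`  — idea `mk-friends`: the `#ᵏ(S¹×S²)`-version of the Manolescu–Piccirillo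
  disc-swap lemma (tree: `Knot.ManolescuPiccirillo2023_lemma33_sphere` is the case `k = 0`),
  with the two hypotheses that are new at `k ≥ 1`: the kernel condition (KC) on the dual knots and
  the meridian condition (MC) on the dotted solid tori.
* `StackLemma`      — idea `s-cobordism-jump`: a smooth h-cobordism `P` of the `0`-surgered
  unlink manifold `Y ≅ #ᵏ(S¹×S²)` to itself plus a concordance in `P` from (the picture of) `K₀`
  to (the picture of) a `♮ᵏ(B²×S²)`-slice `K₁` puts a reparametrised copy of `K₀` into the
  ∃-clause of `DcrRasmussenWitness`.

Conventions are those of `Literature/Topology/FourManifolds/MMSWRasmussen.lean`: model knots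
`K : 𝕊 1 → ℝ⁴` on `∂D_k`, pictures in `S³` by `MMSW.finiteApprox k 0 K` (no twists) in the
complement of the dotted unlink = horizontal circles of radii `4(j+1) + drawRadius k` at height 0.
-/

open scoped Manifold ContDiff Topology
open Function Set

noncomputable section

namespace Summit.SmoothPoincare4.SmoothPoincare4.Cruxes.DcrGap.Sketch

open Literature.Topology.FourManifolds
open Literature.AlgebraicTopology.Homotopy.HopfFibration (wC)

/-- Local notation: `𝔼 n` is the model Euclidean space `EuclideanSpace ℝ (Fin n)`. -/
local notation "𝔼 " n:arg => EuclideanSpace ℝ (Fin n)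

/-- Local notation: `𝕊 n` is the unit sphere in `EuclideanSpace ℝ (Fin (n + 1))`. -/
local notation "𝕊 " n:arg => (Metric.sphere (0 : EuclideanSpace ℝ (Fin (n + 1))) 1)

/-! ## Shared vocabulary -/

/-- The picture in `S³` of the `j`-th dotted circle of `∂D_k`: the horizontal circle of radius
`c_j + C_k = 4(j+1) + 100(k+1)` at height `0`, in the stereographic coordinates of `MMSW.draw`. -/
def dottedPicture (k : ℕ) (j : Fin k) (θ : 𝕊 1) : 𝕊 3 :=
  MMSW.toSphereThree
    ((4 * (((j : ℕ) : ℝ) + 1) + MMSW.drawRadius k) * (θ : 𝔼 2) 0,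
     (4 * (((j : ℕ) : ℝ) + 1) + MMSW.drawRadius k) * (θ : 𝔼 2) 1) 0

/-- `Y` is integral surgery on the framed link `L`, presented WITH NAMED complement embedding `jA`
and solid-torus embeddings `jB` (the body of `IsIntegralSurgeryLink`, with `jA`, `jB` pulled out
of the existential so that the dual knots `v ↦ jB i (0, v)` can be talked about). -/
def PresentsWith {ι : Type} [Finite ι] (L : FramedLink ι) (Y : Type) [TopologicalSpace Y]
    [ChartedSpace (𝔼 3) Y] (jA : L.toLink.complement → Y) (jB : ι → solidTorus → Y) : Prop :=
  ∃ ν : ∀ i, Knot.TubularNbhd (L.component i),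
    (∀ i, (ν i).HasFraming (L.framing i)) ∧
    (Pairwise fun i j ↦ Disjoint (range (ν i)) (range (ν j))) ∧
    Manifold.IsSmoothEmbedding (𝓡 3) (𝓡 3) ∞ jA ∧ IsOpen (range jA) ∧
    (∀ i, Manifold.IsSmoothEmbedding (𝓘(ℝ, 𝔼 2).prod (𝓡 1)) (𝓡 3) ∞ (jB i) ∧
      IsOpen (range (jB i))) ∧
    range jA ∪ (⋃ i, range (jB i)) = univ ∧
    (Pairwise fun i j ↦ Disjoint (range (jB i)) (range (jB j))) ∧
    ∀ i a b, jA a = jB i b ↔ Link.surgeryRel ν i a b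

/-- The core (dual knot) of the `i`-th surgery solid torus. -/
def core {ι : Type} {Y : Type} (jB : ι → solidTorus → Y) (i : ι) (v : 𝕊 1) : Y :=
  jB i ⟨((0 : 𝔼 2), v), by simp⟩

/-- The free loop `γ` of `Y` becomes null-homotopic in `Z` under `g`. -/
def DiesUnder {Y Z : Type} [TopologicalSpace Y] [TopologicalSpace Z] (g : C(Y, Z))
    (γ : 𝕊 1 → Y) : Prop :=
  ∃ (F : C(unitInterval × (𝕊 1), Z)) (z : Z), (∀ v, F (0, v) = g (γ v)) ∧ ∀ v, F (1, v) = z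

/-- A framed link on `Fin (k+1)` whose first `k` components are the dotted unlink picture, last
component the untwisted picture of the model knot `K`, all framings `0` (so surgery on it is
`0`-surgery on `K ⊂ #ᵏ(S¹×S²) = ∂D_k`). -/
def IsPictureLink (k : ℕ) (K : 𝕊 1 → 𝔼 4) (L : FramedLink (Fin (k + 1))) : Prop :=
  (∀ j : Fin k, ⇑(L.component j.castSucc) = dottedPicture k j) ∧
  ⇑(L.component (Fin.last k)) = MMSW.finiteApprox k 0 K ∧
  ∀ i, L.framing i = 0

/-- The framed `0`-framed dotted unlink picture alone (surgery on it is `#ᵏ(S¹×S²)`). -/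
def IsDottedUnlinkPicture (k : ℕ) (L : FramedLink (Fin k)) : Prop :=
  (∀ j : Fin k, ⇑(L.component j) = dottedPicture k j) ∧ ∀ i, L.framing i = 0

/-- The ∃-clause of `DcrRasmussenWitness` for a given model knot: it is slice in the complement
of the dotted handlebody inside SOME homotopy 4-sphere. -/
def HomotopySphereSlice (k : ℕ) (K : 𝕊 1 → 𝔼 4) : Prop :=
  ∃ (M : Type) (_ : TopologicalSpace M) (_ : T2Space M) (_ : SecondCountableTopology M)
    (_ : ChartedSpace (𝔼 4) M) (_ : IsManifold (𝓡 4) ∞ M),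
    Nonempty (ContinuousMap.HomotopyEquiv M (𝕊 4)) ∧
      ∃ (e : 𝔼 4 → M) (f : 𝔼 2 → M), MMSW.IsSliceDiscInComplement k K M e f

/-! ## Idea `mk-friends`: first lemma -/

/-- **Friends one level up** (the `#ᵏ(S¹×S²)`-version of Manolescu–Piccirillo's Lemma 3.3).
Model knots `K₀, K₁ ⊂ ∂D_k`, null-homologous and off the core circles; framed picture links
`L₀ = (dotted unlink, J₀)`, `L₁ = (dotted unlink, J₁)`, `J_i` the untwisted `S³`-picture of
`K_i`, all framings `0`; ONE closed 3-manifold `Y` presented by both (`Y = M_k,0(K₀) = M_k,0(K₁)`: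
"`K₀` and `K₁` are friends in `#ᵏ(S¹×S²)`") such that
(MC) the dotted solid tori of the two presentations coincide as maps, and
(KC) the dual knot of `J₁` dies wherever the dual knot of `J₀` dies (i.e. lies in the normal
closure of the latter in `π₁(Y)`);
if `K₁` bounds a smooth proper disc in `ℝ⁴ ∖ D_k°` that stays out of the holes of the
1-handles (a `B⁴`-type slice disc), then `K₀` bounds a smooth proper disc in `Σ ∖ e(D_k)` for
some homotopy 4-sphere `Σ` (namely `Σ = (D_k ∪ relative trace of K₀) ∪_Y (disc exterior of K₁)`;
(KC) makes `π₁(Σ) = 1`, (MC) lets the meridian discs of the dotted circles close up so that the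
model `D_k ⊂ ℝ⁴` itself is `e(D_k)`). -/
def MkFriendsLemma : Prop :=
  ∀ (k : ℕ) (K₀ K₁ : 𝕊 1 → 𝔼 4),
    MMSW.IsModelKnot k K₀ → MMSW.IsNullHomologous k K₀ → (∀ t, wC (K₀ t) ≠ 0) →
    MMSW.IsModelKnot k K₁ → MMSW.IsNullHomologous k K₁ → (∀ t, wC (K₁ t) ≠ 0) →
    ∀ (L₀ L₁ : FramedLink (Fin (k + 1))), IsPictureLink k K₀ L₀ → IsPictureLink k K₁ L₁ →
    ∀ (Y : Type) [TopologicalSpace Y] [T2Space Y] [SecondCountableTopology Y]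
      [ChartedSpace (𝔼 3) Y] [IsManifold (𝓡 3) ∞ Y]
      (jA₀ : L₀.toLink.complement → Y) (jB₀ : Fin (k + 1) → solidTorus → Y)
      (jA₁ : L₁.toLink.complement → Y) (jB₁ : Fin (k + 1) → solidTorus → Y),
      PresentsWith L₀ Y jA₀ jB₀ → PresentsWith L₁ Y jA₁ jB₁ →
      -- (MC) the dotted solid tori coincide
      (∀ j : Fin k, jB₀ j.castSucc = jB₁ j.castSucc) →
      -- (KC) dual knot of J₁ ∈ normal closure of dual knot of J₀ in π₁(Y)
      (∀ (Z : Type) [TopologicalSpace Z] (g : C(Y, Z)),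
          DiesUnder g (core jB₀ (Fin.last k)) → DiesUnder g (core jB₁ (Fin.last k))) →
      -- K₁ bounds a B⁴-type slice disc in the model complement (out of D_k and out of the holes)
      (∃ f₁ : 𝔼 2 → 𝔼 4, MMSW.IsModelSliceDisc k K₁ f₁ ∧
          ∀ x : 𝔼 2, ‖x‖ < 1 → ∀ j : Fin k, (1 : ℝ) ≤ MMSW.holeTerm k j (f₁ x)) →
      HomotopySphereSlice k K₀

/-- How the line closes the engine crux from the friends lemma: a friends datum whose `K₀` has
`s₋(K₀) > 0` is a `DcrRasmussenWitness` (then `DcrGap` by the route's GFGMW support). -/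
theorem dcrRasmussenWitness_of_friends {k : ℕ} (hk : 1 ≤ k) {K₀ : 𝕊 1 → 𝔼 4}
    (hK : MMSW.IsModelKnot k K₀) (hN : MMSW.IsNullHomologous k K₀)
    (hslice : HomotopySphereSlice k K₀) (w : MMSWRasmussen k K₀) (hw : 0 < w.sMinus) :
    Summit.SmoothPoincare4.SmoothPoincare4.Theses.DottedCircleRasmussen.DcrRasmussenWitness :=
  ⟨k, hk, K₀, hK, hN, hslice, w, Or.inl hw⟩

/-! ## Idea `s-cobordism-jump`: first lemma -/

/-- **Stacking an h-cobordism** of `Y ≅ #ᵏ(S¹×S²)` (presented by the `0`-framed dotted unlink,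
with named embeddings) under the standard `2`-handlebody filling: if `c : Cobordism 3 Y Y` is a
smooth h-cobordism, `κ₀, κ₁ : 𝕊¹ → Y` are the transported pictures of model knots `K₀, K₁`
(through `jA`), `A` is a smooth proper embedded annulus in `c.W` from `c.inl ∘ κ₀` to
`c.inr ∘ κ₁`, and `K₁` bounds a `B⁴`-type slice disc in the model complement, then a
REPARAMETRISED copy `Θ ∘ K₀` of `K₀` (`Θ` a self-diffeomorphism of a neighbourhood of `D_k`
carrying `D_k` onto itself — the price of not controlling the meridian annuli; `s₋` is unchanged
by MMSW Thm. 2.8) is slice in the dotted-handlebody complement of the homotopy 4-sphere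
`Σ = D_k ∪ c.W ∪ (ℝ⁴ ∖ D_k°)^`. -/
def StackLemma : Prop :=
  ∀ (k : ℕ) (K₀ K₁ : 𝕊 1 → 𝔼 4),
    MMSW.IsModelKnot k K₀ → MMSW.IsNullHomologous k K₀ → (∀ t, wC (K₀ t) ≠ 0) →
    MMSW.IsModelKnot k K₁ → MMSW.IsNullHomologous k K₁ → (∀ t, wC (K₁ t) ≠ 0) →
    ∀ (L : FramedLink (Fin k)), IsDottedUnlinkPicture k L →
    ∀ (Y : Type) [TopologicalSpace Y] [T2Space Y] [SecondCountableTopology Y]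
      [ChartedSpace (𝔼 3) Y] [IsManifold (𝓡 3) ∞ Y]
      (jA : L.toLink.complement → Y) (jB : Fin k → solidTorus → Y), PresentsWith L Y jA jB →
    ∀ (κ₀ κ₁ : 𝕊 1 → Y),
      (∀ t, ∃ a : L.toLink.complement, (a : 𝕊 3) = MMSW.finiteApprox k 0 K₀ t ∧ κ₀ t = jA a) →
      (∀ t, ∃ a : L.toLink.complement, (a : 𝕊 3) = MMSW.finiteApprox k 0 K₁ t ∧ κ₁ t = jA a) →
    ∀ (c : Cobordism 3 Y Y), c.IsHCobordism →
    ∀ (A : 𝔼 2 → c.W),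
      ContMDiff (𝓡 2) (𝓡∂ 4) ∞ A →
      InjOn A {x | 1 ≤ ‖x‖ ∧ ‖x‖ ≤ 2} →
      (∀ x : 𝔼 2, 1 ≤ ‖x‖ → ‖x‖ ≤ 2 → Injective (mfderiv (𝓡 2) (𝓡∂ 4) A x)) →
      (∀ t : 𝕊 1, A t = c.inl (κ₀ t)) →
      (∀ t : 𝕊 1, A ((2 : ℝ) • (t : 𝔼 2)) = c.inr (κ₁ t)) →
      (∀ x : 𝔼 2, 1 < ‖x‖ → ‖x‖ < 2 → A x ∉ (𝓡∂ 4).boundary c.W) →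
      (∃ f₁ : 𝔼 2 → 𝔼 4, MMSW.IsModelSliceDisc k K₁ f₁ ∧
          ∀ x : 𝔼 2, ‖x‖ < 1 → ∀ j : Fin k, (1 : ℝ) ≤ MMSW.holeTerm k j (f₁ x)) →
      ∃ (Θ : 𝔼 4 → 𝔼 4) (U : Set (𝔼 4)), IsOpen U ∧ MMSW.modelHandlebody k ⊆ U ∧
        ContDiffOn ℝ ∞ Θ U ∧ InjOn Θ U ∧ (∀ x ∈ U, Function.Bijective (fderiv ℝ Θ x)) ∧
        Θ '' MMSW.modelHandlebody k = MMSW.modelHandlebody k ∧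
        HomotopySphereSlice k (Θ ∘ K₀)

/-- The certificate is carried along the reparametrisation by MMSW Thm. 2.8 (to be vendored as a
named fact: `s₋` is invariant under orientation-preserving self-diffeomorphisms of `∂D_k`); with
it, a stack datum whose `K₀` has `s₋ > 0` again yields `DcrRasmussenWitness`. Stated as the
implication the line needs. -/
def StackCertificateTransport : Prop :=
  ∀ (k : ℕ) (K₀ : 𝕊 1 → 𝔼 4) (Θ : 𝔼 4 → 𝔼 4) (U : Set (𝔼 4)),
    IsOpen U → MMSW.modelHandlebody k ⊆ U → ContDiffOn ℝ ∞ Θ U → InjOn Θ U →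
    (∀ x ∈ U, Function.Bijective (fderiv ℝ Θ x)) →
    Θ '' MMSW.modelHandlebody k = MMSW.modelHandlebody k →
    -- orientation-preserving on ℝ⁴ (hence on ∂D_k with its boundary orientation)
    (∀ x ∈ U, 0 < LinearMap.det (fderiv ℝ Θ x : 𝔼 4 →ₗ[ℝ] 𝔼 4)) →
    ∀ s : ℤ, MMSW.HasSMinus k K₀ s → MMSW.HasSMinus k (Θ ∘ K₀) s

end Summit.SmoothPoincare4.SmoothPoincare4.Cruxes.DcrGap.Sketch

end
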